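import Summits.AtomisticToContinuum.BoseEinsteinCondensation.Theses.BECStronglyRayleigh
import Summits.AtomisticToContinuum.BoseEinsteinCondensation.Theorems.BECStronglyRayleighGroundStateStabilityGibbsStructure
import Literature.MathematicalPhysics.QuantumLattice.LiebMattisSectorPF
import Literature.MathematicalPhysics.QuantumLattice.XYOrderDischarges
import HarnessLib

/-!
# `PenaltySelectsSector` (support item stmt-AtomisticToContinuum-9678 of route BECStronglyRayleigh)

For `L ≥ 1` and `N ≤ L^d`, every ground vector `ψ` of the penalised XY Hamiltonian
`H = xyTorus d L 1 + (d+1)L^d · Q²`, `Q = S³_tot + (L^d/2 - N)·1`, satisfies `Q ψ = 0` (lies in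
the sector of `N` up spins = `N` hard-core bosons). Proof ("a penalty larger than the spectral
width selects the sector"): `Q = diag(L^d - W(σ) - N)` (`W(σ) = Σ_x σ_x`) is an integer diagonal,
so `Q² ≥ 1` off the weight sector `W = L^d - N`, which is nonempty since `N ≤ L^d`; `H_XY`
commutes with `S³_tot` (no matrix elements between different weights) and
`|Re⟨φ, H_XY φ⟩| ≤ (|E|/2)‖φ‖²` from `¼ ∓ Sᵅ_x Sᵅ_y ≥ 0` (`XYOrderDischarges`), with `|E| ≤ d·L^d`
edges on the torus (degree `≤ 2d`); the abstract core `penSel_core` shows that the part of a ground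
vector off `ker Q` is again a ground vector, of energy `≥ c - R` if nonzero, while a basis vector in
`ker Q` has energy `≤ R`, contradicting `2R < c`. Finite-dimensional linear algebra. [folklore]
-/

noncomputable section

namespace Summit.AtomisticToContinuum.BoseEinsteinCondensation.Theorems

open scoped BigOperators Matrix ComplexOrder
open Literature.MathematicalPhysics.QuantumLattice Literature.Probability.LatticeModels
open Matrix Complex Finset EigenvalueContinuation

/-! ### Real parts of quadratic forms -/

section QuadForm

variable {ι : Type*} [Fintype ι]

/-- `Re⟨φ, (A + B)φ⟩ = Re⟨φ, Aφ⟩ + Re⟨φ, Bφ⟩`. [folklore] -/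
theorem penSel_re_quad_add (A B : Matrix ι ι ℂ) (φ : ι → ℂ) :
    (star φ ⬝ᵥ (A + B) *ᵥ φ).re = (star φ ⬝ᵥ A *ᵥ φ).re + (star φ ⬝ᵥ B *ᵥ φ).re := by
  rw [add_mulVec, dotProduct_add, Complex.add_re]

/-- `Re⟨φ, (A - B)φ⟩ = Re⟨φ, Aφ⟩ - Re⟨φ, Bφ⟩`. [folklore] -/
theorem penSel_re_quad_sub (A B : Matrix ι ι ℂ) (φ : ι → ℂ) :
    (star φ ⬝ᵥ (A - B) *ᵥ φ).re = (star φ ⬝ᵥ A *ᵥ φ).re - (star φ ⬝ᵥ B *ᵥ φ).re := by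
  rw [sub_mulVec, dotProduct_sub, Complex.sub_re]

/-- `Re⟨φ, (r • A)φ⟩ = r · Re⟨φ, Aφ⟩` for real `r`. [folklore] -/
theorem penSel_re_quad_real_smul (r : ℝ) (A : Matrix ι ι ℂ) (φ : ι → ℂ) :
    (star φ ⬝ᵥ ((r : ℂ) • A) *ᵥ φ).re = r * (star φ ⬝ᵥ A *ᵥ φ).re := by
  rw [smul_mulVec, dotProduct_smul, smul_eq_mul, Complex.re_ofReal_mul]

/-- `Re⟨φ, (a • 1)φ⟩ = Re a · ‖φ‖²`. [folklore] -/
theorem penSel_re_quad_smul_one [DecidableEq ι] (a : ℂ) (φ : ι → ℂ) :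
    (star φ ⬝ᵥ (a • (1 : Matrix ι ι ℂ)) *ᵥ φ).re = a.re * (star φ ⬝ᵥ φ).re := by
  rw [smul_mulVec, one_mulVec, dotProduct_smul, smul_eq_mul, Complex.mul_re,
    im_star_dotProduct_self, mul_zero, sub_zero]

/-- `Re⟨φ, (Σ_k A_k)φ⟩ = Σ_k Re⟨φ, A_k φ⟩`. [folklore] -/
theorem penSel_re_quad_sum {κ : Type*} (s : Finset κ) (A : κ → Matrix ι ι ℂ) (φ : ι → ℂ) :
    (star φ ⬝ᵥ (∑ k ∈ s, A k) *ᵥ φ).re = ∑ k ∈ s, (star φ ⬝ᵥ A k *ᵥ φ).re := by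
  rw [sum_mulVec, dotProduct_sum, Complex.re_sum]

/-- `Re⟨φ, diag(g) φ⟩ = Σ_i g_i |φ_i|²` for a real diagonal. [folklore] -/
theorem penSel_re_quad_diagonal [DecidableEq ι] (g : ι → ℝ) (φ : ι → ℂ) :
    (star φ ⬝ᵥ (diagonal fun i => (g i : ℂ)) *ᵥ φ).re = ∑ i, g i * ‖φ i‖ ^ 2 := by
  rw [dotProduct, Complex.re_sum]
  refine Finset.sum_congr rfl fun i _ => ?_
  rw [mulVec_diagonal, Pi.star_apply, Complex.star_def, mul_left_comm, Complex.conj_mul',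
    ← Complex.ofReal_pow, ← Complex.ofReal_mul, Complex.ofReal_re]

end QuadForm

/-! ### The abstract penalty lemma -/

section Core

variable {ι : Type*} [Fintype ι] [DecidableEq ι]

/-- **A penalty larger than the spectral width selects the kernel (abstract form).** Let `H₀` be a
Hermitian matrix, `q` a real function on the index set such that `H₀` has no entries between
different level sets of `q`, `|Re⟨φ, H₀ φ⟩| ≤ R ‖φ‖²` for all `φ`, `q` vanishes somewhere, and
`q² ≥ 1` wherever `q ≠ 0`. If `2R < c` then every ground vector of `H₀ + c · diag(q)²` is supported
in `{q = 0}`: writing `ψ = ψ₀ + ψ_b` along `{q = 0}` and its complement, `ψ_b` is again an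
eigenvector for the ground energy `E₀`; if `ψ_b ≠ 0` then `E₀ ≥ c - R`, while a basis vector at a
zero of `q` gives `E₀ ≤ R`, contradicting `2R < c`. [folklore] -/
theorem penSel_core (H₀ : Matrix ι ι ℂ) (hH₀ : H₀.IsHermitian) (q : ι → ℝ) (R c : ℝ)
    (hblock : ∀ i j, q i ≠ q j → H₀ i j = 0)
    (hR : ∀ φ : ι → ℂ, |(star φ ⬝ᵥ H₀ *ᵥ φ).re| ≤ R * (star φ ⬝ᵥ φ).re)
    (hq0 : ∃ i, q i = 0) (hq1 : ∀ i, q i ≠ 0 → 1 ≤ q i ^ 2) (hc : 2 * R < c)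
    {ψ : ι → ℂ} (hψ : ψ ∈ (H₀ + (c : ℂ) • (diagonal fun i => (q i : ℂ)) ^ 2).groundSpace) :
    (diagonal fun i => (q i : ℂ)) *ᵥ ψ = 0 := by
  -- the penalty is the real diagonal matrix `diag(c q²)`
  have hpen : ((c : ℂ) • (diagonal fun i => (q i : ℂ)) ^ 2 : Matrix ι ι ℂ) =
      diagonal fun i => ((c * q i ^ 2 : ℝ) : ℂ) := by
    rw [diagonal_pow, ← diagonal_smul]
    congr 1
    funext i
    simp only [Pi.smul_apply, Pi.pow_apply, smul_eq_mul]
    push_cast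
    ring
  set H : Matrix ι ι ℂ := H₀ + (c : ℂ) • (diagonal fun i => (q i : ℂ)) ^ 2 with hHdef
  have hH' : H = H₀ + diagonal fun i => ((c * q i ^ 2 : ℝ) : ℂ) := by rw [hHdef, hpen]
  have hHerm : H.IsHermitian := by
    rw [hH']
    refine hH₀.add (Matrix.isHermitian_diagonal_iff.mpr fun i => ?_)
    rw [isSelfAdjoint_iff, Complex.star_def, Complex.conj_ofReal]
  -- the ground-vector equation
  set E₀ : ℝ := H.groundEnergy with hE₀
  have hHψ : H *ᵥ ψ = (E₀ : ℂ) • ψ := (Matrix.mem_groundSpace_iff H ψ).1 hψ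
  -- `H` has no entries between different level sets of `q`
  have hHblock : ∀ i j, q i ≠ q j → H i j = 0 := by
    intro i j hij
    have hne : i ≠ j := fun h => hij (by rw [h])
    rw [hH', Matrix.add_apply, hblock i j hij, diagonal_apply_ne _ hne, add_zero]
  -- the quadratic form of `H`
  have hquad : ∀ φ : ι → ℂ, (star φ ⬝ᵥ H *ᵥ φ).re =
      (star φ ⬝ᵥ H₀ *ᵥ φ).re + ∑ i, c * q i ^ 2 * ‖φ i‖ ^ 2 := by
    intro φ
    rw [hH', penSel_re_quad_add, penSel_re_quad_diagonal]
  -- a unit basis vector at a zero of `q`: `R ≥ 0` and `E₀ ≤ R`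
  obtain ⟨i₀, hi₀⟩ := hq0
  set e : ι → ℂ := Pi.single i₀ 1 with he
  have hstar_e : star e = e := by rw [he, ← Pi.single_star, star_one]
  have he1 : star e ⬝ᵥ e = 1 := by rw [hstar_e, he, single_one_dotProduct, Pi.single_eq_same]
  have heR : (star e ⬝ᵥ e).re = 1 := by rw [he1, Complex.one_re]
  have hR0 : 0 ≤ R := by
    have h := hR e
    rw [heR, mul_one] at h
    exact (abs_nonneg _).trans h
  have hup : E₀ ≤ R := by
    have h1 : E₀ ≤ (star e ⬝ᵥ H *ᵥ e).re := Matrix.groundEnergy_le_rayleigh_holds hHerm e he1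
    have h2 : (star e ⬝ᵥ H *ᵥ e).re = (star e ⬝ᵥ H₀ *ᵥ e).re := by
      rw [hquad, add_eq_left]
      refine Finset.sum_eq_zero fun i _ => ?_
      by_cases hi : i = i₀
      · rw [hi, hi₀]
        ring
      · rw [he, Pi.single_eq_of_ne hi, norm_zero]
        ring
    have h3 := (le_abs_self _).trans (hR e)
    rw [heR, mul_one] at h3
    linarith
  -- the part of `ψ` off `ker q` is again an eigenvector for `E₀`
  set ψb : ι → ℂ := fun i => if q i = 0 then 0 else ψ i with hψb
  have hψb_apply : ∀ i, ψb i = if q i = 0 then 0 else ψ i := fun i => rfl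
  have hHψb : H *ᵥ ψb = (E₀ : ℂ) • ψb := by
    funext i
    rw [Pi.smul_apply, smul_eq_mul, mulVec, dotProduct, hψb_apply i]
    by_cases hi : q i = 0
    · rw [if_pos hi, mul_zero]
      refine Finset.sum_eq_zero fun j _ => ?_
      rw [hψb_apply j]
      by_cases hj : q j = 0
      · rw [if_pos hj, mul_zero]
      · rw [if_neg hj, hHblock i j (by rw [hi]; exact Ne.symm hj), zero_mul]
    · have h1 := congrFun hHψ i
      rw [Pi.smul_apply, smul_eq_mul, mulVec, dotProduct] at h1
      rw [if_neg hi, ← h1]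
      refine Finset.sum_congr rfl fun j _ => ?_
      rw [hψb_apply j]
      by_cases hj : q j = 0
      · rw [if_pos hj, hHblock i j (by rw [hj]; exact hi), zero_mul, zero_mul]
      · rw [if_neg hj]
  -- and it vanishes
  have hψb0 : ψb = 0 := by
    by_contra hne
    have hpos : 0 < (star ψb ⬝ᵥ ψb).re := re_star_dotProduct_self_pos hne
    have hE : (star ψb ⬝ᵥ H *ᵥ ψb).re = E₀ * (star ψb ⬝ᵥ ψb).re :=
      re_star_dotProduct_mulVec_of_eigen hHψb
    have hpenb : c * (star ψb ⬝ᵥ ψb).re ≤ ∑ i, c * q i ^ 2 * ‖ψb i‖ ^ 2 := by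
      rw [re_star_dotProduct_self, Finset.mul_sum]
      refine Finset.sum_le_sum fun i _ => ?_
      by_cases hi : q i = 0
      · have h0 : ψb i = 0 := by rw [hψb_apply i, if_pos hi]
        rw [h0, norm_zero]
        ring_nf
        rfl
      · have hc0 : 0 ≤ c := by linarith
        calc c * ‖ψb i‖ ^ 2 = c * ‖ψb i‖ ^ 2 * 1 := by ring
          _ ≤ c * ‖ψb i‖ ^ 2 * q i ^ 2 :=
            mul_le_mul_of_nonneg_left (hq1 i hi) (mul_nonneg hc0 (sq_nonneg _))
          _ = c * q i ^ 2 * ‖ψb i‖ ^ 2 := by ring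
    have hlow : c - R ≤ E₀ := by
      have h1 : -(R * (star ψb ⬝ᵥ ψb).re) ≤ (star ψb ⬝ᵥ H₀ *ᵥ ψb).re := (abs_le.1 (hR ψb)).1
      have h3 := hE
      rw [hquad] at h3
      have h4 : (c - R) * (star ψb ⬝ᵥ ψb).re ≤ E₀ * (star ψb ⬝ᵥ ψb).re := by nlinarith
      exact le_of_mul_le_mul_right h4 hpos
    linarith
  -- conclusion: `diag(q) ψ = 0`
  funext i
  rw [Pi.zero_apply, mulVec_diagonal]
  by_cases hi : q i = 0
  · rw [hi, Complex.ofReal_zero, zero_mul]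
  · have h := congrFun hψb0 i
    rw [hψb_apply i, if_neg hi, Pi.zero_apply] at h
    rw [h, mul_zero]

end Core

/-! ### Lattice facts: edges of the torus, the XY quadratic form, weights -/

section Lattice

variable {Λ : Type*} [Fintype Λ] [DecidableEq Λ]

/-- **`|Re⟨φ, Sᵅ_x Sᵅ_y φ⟩| ≤ ¼‖φ‖²` for spin `½`**, from `¼ ∓ Sᵅ_x Sᵅ_y ≥ 0`
(`posSemidef_sq_smul_one_sub/add_siteSpin_mul'`). [folklore] -/
theorem penSel_re_quad_siteSpin_mul_abs_le (x y : Λ) (α : Fin 3) (φ : TensorIndex Λ 2 → ℂ) :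
    |(star φ ⬝ᵥ (siteSpin 1 x α * siteSpin 1 y α) *ᵥ φ).re| ≤ 1 / 4 * (star φ ⬝ᵥ φ).re := by
  have hc : ((((1 : ℕ) : ℂ) / 2) ^ 2).re = 1 / 4 := by norm_num
  have h1 := (posSemidef_sq_smul_one_sub_siteSpin_mul' 1 x y α).re_dotProduct_nonneg φ
  have h2 := (posSemidef_sq_smul_one_add_siteSpin_mul' 1 x y α).re_dotProduct_nonneg φ
  rw [RCLike.re_to_complex, penSel_re_quad_sub, penSel_re_quad_smul_one, hc] at h1
  rw [RCLike.re_to_complex, penSel_re_quad_add, penSel_re_quad_smul_one, hc] at h2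
  rw [abs_le]
  constructor <;> linarith

/-- `|Re⟨φ, ½(Sᵅ_x Sᵅ_y + Sᵅ_y Sᵅ_x) φ⟩| ≤ ¼‖φ‖²` for spin `½`. [folklore] -/
theorem penSel_re_quad_spinBond_abs_le (x y : Λ) (α : Fin 3) (φ : TensorIndex Λ 2 → ℂ) :
    |(star φ ⬝ᵥ (spinBond 1 α x y) *ᵥ φ).re| ≤ 1 / 4 * (star φ ⬝ᵥ φ).re := by
  have hxy := abs_le.1 (penSel_re_quad_siteSpin_mul_abs_le x y α φ)
  have hyx := abs_le.1 (penSel_re_quad_siteSpin_mul_abs_le y x α φ)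
  have h : (star φ ⬝ᵥ (spinBond 1 α x y) *ᵥ φ).re =
      1 / 2 * ((star φ ⬝ᵥ (siteSpin 1 x α * siteSpin 1 y α) *ᵥ φ).re +
        (star φ ⬝ᵥ (siteSpin 1 y α * siteSpin 1 x α) *ᵥ φ).re) := by
    rw [spinBond, show (1 / 2 : ℂ) = ((1 / 2 : ℝ) : ℂ) by push_cast; ring,
      penSel_re_quad_real_smul, penSel_re_quad_add]
  rw [h, abs_le]
  constructor <;> linarith [hxy.1, hxy.2, hyx.1, hyx.2]

/-- **The XY quadratic form is bounded by half the number of edges**: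
`|Re⟨φ, H φ⟩| ≤ (|E|/2)‖φ‖²` for `H = xxzHamiltonian 1 G (-1) 0 = -Σ_{xy∈E} (S¹_xS¹_y + S²_xS²_y)`
(each bond term has `|Re⟨φ, · φ⟩| ≤ ½‖φ‖²`). [folklore] -/
theorem penSel_re_quad_xy_abs_le (G : SimpleGraph Λ) [DecidableRel G.Adj]
    (φ : TensorIndex Λ 2 → ℂ) :
    |(star φ ⬝ᵥ (xxzHamiltonian 1 G (-1) 0) *ᵥ φ).re| ≤
      (G.edgeFinset.card : ℝ) / 2 * (star φ ⬝ᵥ φ).re := by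
  have hbond : ∀ e : Sym2 Λ,
      |(star φ ⬝ᵥ (Sym2.lift ⟨fun x y => spinBond 1 0 x y + spinBond 1 1 x y +
          (((0 : ℝ) : ℂ)) • spinBond 1 2 x y, fun x y => by simp only [spinBond_comm]⟩ e :
            Op Λ 2) *ᵥ φ).re| ≤ 1 / 2 * (star φ ⬝ᵥ φ).re := by
    intro e
    induction e using Sym2.ind with
    | h x y =>
      simp only [Sym2.lift_mk]
      have h0 := abs_le.1 (penSel_re_quad_spinBond_abs_le x y 0 φ)
      have h1 := abs_le.1 (penSel_re_quad_spinBond_abs_le x y 1 φ)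
      rw [penSel_re_quad_add, penSel_re_quad_add, penSel_re_quad_real_smul, zero_mul, add_zero,
        abs_le]
      constructor <;> linarith [h0.1, h0.2, h1.1, h1.2]
  unfold xxzHamiltonian
  rw [penSel_re_quad_real_smul, penSel_re_quad_sum, neg_one_mul, abs_neg]
  calc |∑ e ∈ G.edgeFinset, (star φ ⬝ᵥ (Sym2.lift ⟨fun x y => spinBond 1 0 x y +
          spinBond 1 1 x y + (((0 : ℝ) : ℂ)) • spinBond 1 2 x y,
            fun x y => by simp only [spinBond_comm]⟩ e : Op Λ 2) *ᵥ φ).re|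
        ≤ ∑ e ∈ G.edgeFinset, |(star φ ⬝ᵥ (Sym2.lift ⟨fun x y => spinBond 1 0 x y +
          spinBond 1 1 x y + (((0 : ℝ) : ℂ)) • spinBond 1 2 x y,
            fun x y => by simp only [spinBond_comm]⟩ e : Op Λ 2) *ᵥ φ).re| :=
          Finset.abs_sum_le_sum_abs _ _
    _ ≤ ∑ _e ∈ G.edgeFinset, 1 / 2 * (star φ ⬝ᵥ φ).re := Finset.sum_le_sum fun e _ => hbond e
    _ = (G.edgeFinset.card : ℝ) / 2 * (star φ ⬝ᵥ φ).re := by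
          rw [Finset.sum_const, nsmul_eq_mul]
          ring

/-- **The XY / hard-core XXZ Hamiltonian commutes with `S³_tot`** (particle-number conservation;
`gibbsStr_entries` with zero field). [folklore] -/
theorem penSel_commute_xxz_totalSpin_two (G : SimpleGraph Λ) [DecidableRel G.Adj] (Δ : ℝ) :
    Commute (xxzHamiltonian 1 G (-1) Δ : Op Λ 2) (totalSpin 1 2) := by
  have h := (Summit.AtomisticToContinuum.BoseEinsteinCondensation.Cruxes.GroundStateStability.StableConeVariationalSelection.gibbsStr_entries
    G Δ fun _ => (0 : ℝ)).2.2.1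
  simpa using h

/-- **Every weight `W ≤ |Λ|` is attained** by a spin-`½` configuration (put `W` down spins on a
`W`-subset). [folklore] -/
theorem penSel_exists_weight {W : ℕ} (hW : W ≤ Fintype.card Λ) :
    ∃ σ : TensorIndex Λ 2, (∑ x, (σ x : ℕ)) = W := by
  obtain ⟨t, -, ht⟩ := Finset.exists_subset_card_eq (s := (Finset.univ : Finset Λ)) (n := W)
    (by rwa [Finset.card_univ])
  refine ⟨fun x => if x ∈ t then 1 else 0, ?_⟩
  have h : ∀ x : Λ, (((if x ∈ t then (1 : Fin 2) else 0) : Fin 2) : ℕ) =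
      if x ∈ t then 1 else 0 := by
    intro x
    split_ifs <;> rfl
  simp_rw [h]
  rw [Finset.sum_boole, Nat.cast_id, Finset.filter_mem_eq_inter, Finset.univ_inter, ht]

/-- **The torus `(ℤ/Lℤ)^d` has at most `d·L^d` edges**: every vertex `x` has its neighbours among
the `2d` points `x ± eᵢ`, and `Σ_x deg x = 2|E|`. (For `L ≥ 3` equality holds; for `L ≤ 2` the two
directions coincide.) [folklore] -/
theorem penSel_card_edgeFinset_torusGraph_le (d L : ℕ) [NeZero L] :
    (torusGraph d L).edgeFinset.card ≤ d * L ^ d := by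
  have hdeg : ∀ x : TorusSite d L, (torusGraph d L).degree x ≤ 2 * d := by
    intro x
    rw [← SimpleGraph.card_neighborFinset_eq_degree]
    have hsub : (torusGraph d L).neighborFinset x ⊆
        (Finset.univ.image fun i : Fin d => x + Pi.single i 1) ∪
          (Finset.univ.image fun i : Fin d => x - Pi.single i 1) := by
      intro y hy
      rw [SimpleGraph.mem_neighborFinset, torusGraph_adj_iff] at hy
      obtain ⟨-, ⟨i, hi⟩ | ⟨i, hi⟩⟩ := hy
      · exact Finset.mem_union_left _ (Finset.mem_image.2 ⟨i, Finset.mem_univ _, hi.symm⟩)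
      · refine Finset.mem_union_right _ (Finset.mem_image.2 ⟨i, Finset.mem_univ _, ?_⟩)
        rw [hi, add_sub_cancel_right]
    calc ((torusGraph d L).neighborFinset x).card
        ≤ ((Finset.univ.image fun i : Fin d => x + Pi.single i 1) ∪
            (Finset.univ.image fun i : Fin d => x - Pi.single i 1)).card := Finset.card_le_card hsub
      _ ≤ (Finset.univ.image fun i : Fin d => x + Pi.single i 1).card +
            (Finset.univ.image fun i : Fin d => x - Pi.single i 1).card := Finset.card_union_le _ _
      _ ≤ d + d := add_le_add (Finset.card_image_le.trans (by simp))
            (Finset.card_image_le.trans (by simp))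
      _ = 2 * d := by ring
  have hcard : Fintype.card (TorusSite d L) = L ^ d := by
    simp [Fintype.card_pi, ZMod.card]
  have h2 : 2 * (torusGraph d L).edgeFinset.card ≤ 2 * (d * L ^ d) := by
    rw [← SimpleGraph.sum_degrees_eq_twice_card_edges]
    calc ∑ x, (torusGraph d L).degree x ≤ ∑ _x : TorusSite d L, 2 * d :=
          Finset.sum_le_sum fun x _ => hdeg x
      _ = 2 * (d * L ^ d) := by
          rw [Finset.sum_const, Finset.card_univ, hcard, smul_eq_mul]
          ring
  omega

end Lattice

/-! ### The item -/

/-- **Penalty selects the sector (explicit form).** For `L ≥ 1` and `N ≤ L^d`, every ground vector of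
`xyTorus d L 1 + (d+1)L^d (S³_tot + (L^d/2 - N))²` is annihilated by `S³_tot + (L^d/2 - N)`, i.e.
has exactly `N` up spins: `S³_tot + L^d/2 - N = diag(L^d - W(σ) - N)` is an integer diagonal, the XY
Hamiltonian preserves the weight and has `|Re⟨φ, H_XY φ⟩| ≤ (|E|/2)‖φ‖²`, `|E| ≤ d L^d < (d+1)L^d`,
and `penSel_core` applies. [folklore] -/
theorem penSel_main (d L : ℕ) [NeZero L] (N : ℕ) (hN : N ≤ L ^ d)
    (ψ : TensorIndex (TorusSite d L) 2 → ℂ)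
    (hψ : ψ ∈ (xyTorus d L 1 + (((d + 1) * L ^ d : ℕ) : ℂ) •
      (totalSpin 1 2 + ((L : ℂ) ^ d / 2 - (N : ℂ)) • 1) ^ 2).groundSpace) :
    (totalSpin (Λ := TorusSite d L) 1 2 + ((L : ℂ) ^ d / 2 - (N : ℂ)) • 1) *ᵥ ψ = 0 := by
  have hcard : Fintype.card (TorusSite d L) = L ^ d := by
    simp [Fintype.card_pi, ZMod.card]
  -- `Q = S³_tot + (L^d/2 - N)·1` is the real diagonal `diag(L^d - W(σ) - N)`
  have hQ : (totalSpin (Λ := TorusSite d L) 1 2 + ((L : ℂ) ^ d / 2 - (N : ℂ)) • 1 :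
      Op (TorusSite d L) 2) =
      diagonal fun σ => (((L : ℝ) ^ d - ((∑ x, (σ x : ℕ) : ℕ) : ℝ) - N : ℝ) : ℂ) := by
    rw [LiebMattis.totalSpin_two_eq_diagonal, smul_one_eq_diagonal, diagonal_add]
    congr 1
    funext σ
    rw [LiebMattis.magnetisation_eq_sub_weight, hcard]
    push_cast
    ring
  have hc : ((((d + 1) * L ^ d : ℕ) : ℂ)) = (((((d + 1) * L ^ d : ℕ) : ℝ)) : ℂ) := by
    norm_cast
  rw [hQ, hc] at hψ
  rw [hQ]
  refine penSel_core (xyTorus d L 1) (xyTorus_isHermitian d L 1) _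
    ((torusGraph d L).edgeFinset.card / 2) _ ?_ ?_ ?_ ?_ ?_ hψ
  · -- the XY Hamiltonian preserves the weight
    intro σ τ hστ
    refine LiebMattis.apply_eq_zero_of_commute_totalSpin_two 1
      (penSel_commute_xxz_totalSpin_two (torusGraph d L) 0) (fun hW => hστ ?_)
    simp only [hW]
  · -- spectral-width bound
    exact penSel_re_quad_xy_abs_le (torusGraph d L)
  · -- the sector `W = L^d - N` is nonempty
    obtain ⟨σ, hσ⟩ := penSel_exists_weight (Λ := TorusSite d L) (W := L ^ d - N)
      (by rw [hcard]; exact Nat.sub_le _ _)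
    refine ⟨σ, ?_⟩
    simp only [hσ]
    push_cast [Nat.cast_sub hN]
    ring
  · -- integrality: `(L^d - W - N)² ≥ 1` unless it vanishes
    intro σ hσ
    have hk : ((L : ℝ) ^ d - ((∑ x, (σ x : ℕ) : ℕ) : ℝ) - N : ℝ) =
        (((L ^ d : ℕ) : ℤ) - ((∑ x, (σ x : ℕ) : ℕ) : ℤ) - (N : ℤ) : ℤ) := by
      push_cast
      ring
    rw [hk] at hσ ⊢
    have hk0 : (((L ^ d : ℕ) : ℤ) - ((∑ x, (σ x : ℕ) : ℕ) : ℤ) - (N : ℤ) : ℤ) ≠ 0 := by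
      exact_mod_cast hσ
    have h1 : (1 : ℤ) ≤ (((L ^ d : ℕ) : ℤ) - ((∑ x, (σ x : ℕ) : ℕ) : ℤ) - (N : ℤ) : ℤ) ^ 2 :=
      (one_le_sq_iff_one_le_abs _).mpr (Int.one_le_abs hk0)
    exact_mod_cast h1
  · -- the penalty exceeds the width: `|E| ≤ d L^d < (d+1) L^d`
    have hE : ((torusGraph d L).edgeFinset.card : ℝ) ≤ (d : ℝ) * (L : ℝ) ^ d := by
      exact_mod_cast penSel_card_edgeFinset_torusGraph_le d L
    have hL : (0 : ℝ) < (L : ℝ) ^ d := pow_pos (by exact_mod_cast Nat.pos_of_ne_zero (NeZero.ne L)) d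
    push_cast
    nlinarith

end Summit.AtomisticToContinuum.BoseEinsteinCondensation.Theorems

/-- **`PenaltySelectsSector`** (item stmt-AtomisticToContinuum-9678 of route BECStronglyRayleigh,
concluded BY NAME): for `d ≥ 1`, `L ≥ 1`, `N ≤ L^d` every ground vector of
`xyTorus d L 1 + (d+1)L^d·(S³_tot + (L^d/2 − N)·1)²` lies in the sector of `N` up spins (bosons) —
the penalty `(d+1)L^d` exceeds the spectral width `≤ |E| ≤ d·L^d` of the XY Hamiltonian and the
sector is nonempty. [folklore] -/
theorem Summit.AtomisticToContinuum.BoseEinsteinCondensation.Theorems.PenaltySelectsSector_proof :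
    Summit.AtomisticToContinuum.BoseEinsteinCondensation.Theses.BECStronglyRayleigh.PenaltySelectsSector := by
  unfold Summit.AtomisticToContinuum.BoseEinsteinCondensation.Theses.BECStronglyRayleigh.PenaltySelectsSector
  intro d L _ N _hd hN ψ hψ
  exact Summit.AtomisticToContinuum.BoseEinsteinCondensation.Theorems.penSel_main d L N hN ψ hψ
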